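import Literature.Probability.LatticeModels.DomainDiscretisation
import Mathlib.Combinatorics.SimpleGraph.Walk.Operations
import HarnessLib

/-!
# Screening recursion for `SAWCircleScreening`, part XIb: screens in the route's `getVert` phrasing

Route `SAWCircleScreening` of `CriticalPhenomena/SAWScalingLimit`, support item
`ScreeningRecursion` (stmt-CriticalPhenomena-5468). The cruxes `ScreenOverlap`, `NoDeepReturn`
quantify over `i ≤ γ.walk.length` and read vertices through `γ.walk.getVert i`; the coupling step
works with the support list. This file translates: `sc_walk_iff` ("crossed exactly once"),
`screenClause_walk_iff` (crossing index and exit edge, when the endpoint is outside the circle),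
`deepReturn_walk_iff` (deep returns). Folklore; Mathlib anchor
`SimpleGraph.Walk.getVert_eq_support_getElem`.
-/

open Set Metric
open Literature.Probability.LatticeModels

namespace Summit.CriticalPhenomena.SAWScalingLimit.Theorems.ScreeningRecursion

variable {δ : ℝ} {c : ℂ}

/-! ## Translation from the route's `getVert` phrasing -/

/-- A walk's `i`-th vertex is the `i`-th entry of its support (`i ≤ length`). [folklore] -/
theorem getVert_eq_getElem_support {G : SimpleGraph (Site 2)} {u v : Site 2} (p : G.Walk u v)
    {i : ℕ} (hi : i < p.support.length) :
    p.getVert i = p.support[i] := by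
  have hi' : i ≤ p.length := by rw [SimpleGraph.Walk.length_support] at hi; omega
  exact SimpleGraph.Walk.getVert_eq_support_getElem p hi'

/-- **"Crossed exactly once": walk form ↔ support form.** [folklore] -/
theorem sc_walk_iff {G : SimpleGraph (Site 2)} {u v : Site 2} (p : G.Walk u v) (r : ℝ) :
    (∃ k : ℕ, ∀ i ≤ p.length, (dist (meshPoint δ (p.getVert i)) c < r ↔ i ≤ k)) ↔
      ∃ k : ℕ, ∀ i : ℕ, (hi : i < p.support.length) →
        (dist (meshPoint δ (p.support[i])) c < r ↔ i ≤ k) := by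
  have hls : p.support.length = p.length + 1 := SimpleGraph.Walk.length_support p
  constructor
  · rintro ⟨k, hk⟩
    refine ⟨k, fun i hi => ?_⟩
    rw [← getVert_eq_getElem_support p hi]
    exact hk i (by omega)
  · rintro ⟨k, hk⟩
    refine ⟨k, fun i hi => ?_⟩
    rw [getVert_eq_getElem_support p (by omega)]
    exact hk i (by omega)

/-- **The exit edge: walk form ↔ support form**, when the endpoint of the walk is outside the
circle (then the crossing index `k` is `< length`, so `getVert k`, `getVert (k+1)` are genuine
support entries). [folklore] -/
theorem screenClause_walk_iff {G : SimpleGraph (Site 2)} {u v : Site 2} (p : G.Walk u v) (r : ℝ)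
    (hv : r ≤ dist (meshPoint δ v) c) (x y : Site 2) :
    (∃ k : ℕ, (∀ i ≤ p.length, (dist (meshPoint δ (p.getVert i)) c < r ↔ i ≤ k)) ∧
        p.getVert k = x ∧ p.getVert (k + 1) = y) ↔
      ∃ k : ℕ, (∀ i : ℕ, (hi : i < p.support.length) →
          (dist (meshPoint δ (p.support[i])) c < r ↔ i ≤ k)) ∧
        p.support[k]? = some x ∧ p.support[k + 1]? = some y := by
  have hls : p.support.length = p.length + 1 := SimpleGraph.Walk.length_support p
  constructor
  · rintro ⟨k, hk, hkx, hky⟩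
    have hklt : k < p.length := by
      by_contra hle
      push Not at hle
      have := (hk p.length le_rfl).2 hle
      rw [SimpleGraph.Walk.getVert_length] at this
      linarith
    refine ⟨k, fun i hi => ?_, ?_, ?_⟩
    · rw [← getVert_eq_getElem_support p hi]; exact hk i (by omega)
    · rw [List.getElem?_eq_getElem (by omega), ← getVert_eq_getElem_support p (by omega), hkx]
    · rw [List.getElem?_eq_getElem (by omega), ← getVert_eq_getElem_support p (by omega), hky]
  · rintro ⟨k, hk, hkx, hky⟩
    have hk1 : k + 1 < p.support.length := by
      rcases Nat.lt_or_ge (k + 1) p.support.length with h | h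
      · exact h
      · rw [List.getElem?_eq_none h] at hky; exact absurd hky (by simp)
    refine ⟨k, fun i hi => ?_, ?_, ?_⟩
    · rw [getVert_eq_getElem_support p (by omega)]; exact hk i (by omega)
    · have := List.getElem?_eq_getElem (l := p.support) (by omega : k < p.support.length)
      rw [this] at hkx
      rw [getVert_eq_getElem_support p (by omega)]
      exact Option.some.inj hkx
    · have := List.getElem?_eq_getElem (l := p.support) hk1
      rw [this] at hky
      rw [getVert_eq_getElem_support p hk1]
      exact Option.some.inj hky

/-- **Deep returns: walk form ↔ support form.** [folklore] -/
theorem deepReturn_walk_iff {G : SimpleGraph (Site 2)} {u v : Site 2} (p : G.Walk u v) (R₁ R₂ : ℝ) :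
    (∃ i i' : ℕ, i < i' ∧ i' ≤ p.length ∧ R₁ ≤ dist (meshPoint δ (p.getVert i)) c ∧
        dist (meshPoint δ (p.getVert i')) c < R₂) ↔
      ∃ i i' : ℕ, ∃ (hi : i < p.support.length) (hi' : i' < p.support.length), i < i' ∧
        R₁ ≤ dist (meshPoint δ (p.support[i])) c ∧ dist (meshPoint δ (p.support[i'])) c < R₂ := by
  have hls : p.support.length = p.length + 1 := SimpleGraph.Walk.length_support p
  constructor
  · rintro ⟨i, i', hii', hi', h1, h2⟩
    refine ⟨i, i', by omega, by omega, hii', ?_, ?_⟩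
    · rwa [← getVert_eq_getElem_support p (by omega)]
    · rwa [← getVert_eq_getElem_support p (by omega)]
  · rintro ⟨i, i', hi, hi', hii', h1, h2⟩
    refine ⟨i, i', hii', by omega, ?_, ?_⟩
    · rwa [getVert_eq_getElem_support p hi]
    · rwa [getVert_eq_getElem_support p hi']

end Summit.CriticalPhenomena.SAWScalingLimit.Theorems.ScreeningRecursion
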